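import Summits.PneNP.PneNP.Theorems.ExpanderLinearGeneratorsColumnTwoCore
import Summits.PneNP.PneNP.Theorems.ExpanderLinearGeneratorsColumnTwoMinor
import Summits.PneNP.PneNP.Theorems.ExpanderLinearGeneratorsColumnTwoSystem

/-!
# PneNP / ExpanderLinearGenerators — column weight two: a large clique minor inside every odd
component of an expanding system

Route `PneNP/ExpanderLinearGenerators`, support for crux stmt-PneNP-11443. The combinatorial
pipeline of the routing reduction, run inside one closed component `K` of a system
`E : Fin m → LinEqMod 2 n` of column weight `≤ 2` whose row supports (size `≤ ℓ`) form an
`(R, 3ℓ/4)`-boundary expander: `K` has more than `r ≤ R` rows, is locally sparse, contains a dense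
core (`exists_dense_core`) whose small sets expand by `1.488` (`nbr_small`) and whose halves expand
by `3/(4K)` with `K = 1000 Λ(Λ+1)`, `2^Λ > m` (`card_le_nbr`); hence it contains `p` disjoint
connected `q`-sets (`exists_branch_family`) and a clique minor on `≥ p/6 = m₁` of them
(`exists_clique_minor`), which we index by `Fin m₁`.

* `exists_minor_in_component` — the `K_{m₁}` minor model in `K`, under the volume condition
  `(12K+3)(pq + p²L) + 3 ≤ r`, `p = 6 m₁`, `q = 8pL`, `L = 2(s+1) + 2(t+1)`.

[folklore; Krivelevich 2018 + Krivelevich–Sudakov 2009 inside Urquhart–Fu / Ben-Sasson routing]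
-/

namespace Summit.PneNP.PneNP.Theorems.ColumnTwo

open Finset Literature.Computability.MetaComplexity

variable {m n : ℕ}

/-- Rows of an expanding system are few: `m ≤ 2n` when every variable lies in `≤ 2` rows and every
row has a variable. [folklore] -/
theorem card_rows_le (E : Fin m → LinEqMod 2 n)
    (hcol : ∀ j : Fin n, (Finset.univ.filter fun i => j ∈ (E i).supp).card ≤ 2)
    (hdeg : ∀ i, 0 < (E i).supp.card) : m ≤ 2 * n := by
  have h1 : m ≤ ∑ i : Fin m, (E i).supp.card := by
    calc m = ∑ i : Fin m, 1 := by simp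
      _ ≤ _ := Finset.sum_le_sum fun i _ => hdeg i
  have h2 : ∑ i : Fin m, (E i).supp.card = ∑ j : Fin n, (Finset.univ.filter fun i => j ∈ (E i).supp).card := by
    simp_rw [Finset.card_eq_sum_ones ((E _).supp), Finset.card_eq_sum_ones (Finset.univ.filter _)]
    rw [Finset.sum_comm' (t' := Finset.univ) (s' := fun j => Finset.univ.filter fun i => j ∈ (E i).supp)]
    intro i j
    simp
  have h3 : ∑ j : Fin n, (Finset.univ.filter fun i => j ∈ (E i).supp).card ≤ ∑ j : Fin n, 2 :=
    Finset.sum_le_sum fun j _ => hcol j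
  rw [Finset.sum_const, Finset.card_univ, Fintype.card_fin, smul_eq_mul] at h3
  omega

/-- **A clique minor of order `m₁` inside a closed component.** [folklore] -/
theorem exists_minor_in_component (E : Fin m → LinEqMod 2 n) {ℓ r Λ p q s t m₁ : ℕ} {R : ℝ}
    (hcol : ∀ j : Fin n, (Finset.univ.filter fun i => j ∈ (E i).supp).card ≤ 2)
    (hℓ : ∀ i, (E i).supp.card ≤ ℓ) (hℓ1 : 1 ≤ ℓ)
    (hexp : IsBoundaryExpander (fun i => (E i).supp.map Fin.valEmbedding) R (3 / 4 * ℓ))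
    (hrR : (r : ℝ) ≤ R) (hR1 : 1 ≤ R) (hmΛ : m < 2 ^ Λ)
    {K : Finset (Fin m)} (hKne : K.Nonempty)
    (hKc : IsConn (fun i => (E i).supp.map Fin.valEmbedding) K)
    (hKb : boundary (fun i => (E i).supp.map Fin.valEmbedding) K = ∅)
    (ht : 4 ^ t * r < 3 * 5 ^ t)
    (hs : (2 * (1000 * Λ * (Λ + 1))) ^ s * m < (2 * (1000 * Λ * (Λ + 1)) + 1) ^ s)
    (hp : p = 6 * m₁) (hq : q = 8 * p * (2 * (s + 1) + 2 * (t + 1))) (hm₁ : 1 ≤ m₁)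
    (hvol : (12 * (1000 * Λ * (Λ + 1)) + 3) * (p * q + p * p * (2 * (s + 1) + 2 * (t + 1))) + 3 ≤ r) :
    ∃ T : Fin m₁ → Finset (Fin m),
      (∀ a, T a ⊆ K ∧ IsConn (fun i => (E i).supp.map Fin.valEmbedding) (T a) ∧ (T a).Nonempty) ∧
      (∀ a b, a ≠ b → Disjoint (T a) (T b)) ∧
      (∀ a b, a ≠ b → ∃ i ∈ T a, ∃ j ∈ T b,
        ((E i).supp.map Fin.valEmbedding ∩ (E j).supp.map Fin.valEmbedding).Nonempty) := by
  classical
  set S : Fin m → Finset ℕ := fun i => (E i).supp.map Fin.valEmbedding with hS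
  set Kx : ℕ := 1000 * Λ * (Λ + 1) with hKx
  set L : ℕ := 2 * (s + 1) + 2 * (t + 1) with hL
  have hcw := coverDegree_le_two_of_col E hcol
  have hℓ' : ∀ i, (S i).card ≤ ℓ := fun i => by simp only [hS, Finset.card_map]; exact hℓ i
  have hc : (0 : ℝ) < 3 / 4 * ℓ := mul_pos (by norm_num) (by exact_mod_cast hℓ1)
  -- expansion in integers, for sets of at most `r` rows
  have hexpZ : ∀ W : Finset (Fin m), W.card ≤ r → 3 * ∑ i ∈ W, (S i).card ≤ 4 * (boundary S W).card :=
    fun W hW => three_mul_sum_le hℓ' hexp (le_trans (by exact_mod_cast hW) hrR)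
  have hexp1 : ∀ i, 3 * ℓ ≤ 4 * (S i).card := by
    intro i
    have h1 := hexp {i} (by simpa using hR1)
    have h2 : (boundary S {i}).card ≤ (S i).card :=
      (Finset.card_le_card (boundary_subset_cover _)).trans (by simp [cover])
    have h3 : (3 / 4 * ℓ : ℝ) ≤ (S i).card := by
      have : (3 / 4 * ℓ : ℝ) * (({i} : Finset (Fin m)).card : ℝ) = 3 / 4 * ℓ := by simp
      have h2' : ((boundary S {i}).card : ℝ) ≤ (S i).card := by exact_mod_cast h2
      linarith
    have : (3 * ℓ : ℝ) ≤ 4 * (S i).card := by linarith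
    exact_mod_cast this
  have hdeg : ∀ i, 0 < (S i).card := fun i => by have := hexp1 i; omega
  -- `|K| > r`
  have hKr : r < K.card := by
    by_contra hle
    push Not at hle
    have h1 := hexpZ K hle
    rw [hKb, Finset.card_empty, mul_zero] at h1
    obtain ⟨i, hi⟩ := hKne
    have h2 : (S i).card ≤ ∑ j ∈ K, (S j).card :=
      Finset.single_le_sum (f := fun j => (S j).card) (fun j _ => Nat.zero_le _) hi
    have := hdeg i
    omega
  -- local sparsity
  have hLS : ∀ W ⊆ K, W.card ≤ r → 8 * eIn S W ≤ ∑ k ∈ W, (S k).card :=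
    fun W _ hW => eight_mul_eIn_le hcw (hexpZ W hW)
  -- the dense core
  obtain ⟨U, hUK, i, hi2, hUr, htouch, hstop⟩ :=
    exists_dense_core hcw hKb hKr (fun k _ => hdeg k) hLS
  have hiΛ : i + 1 ≤ Λ := by
    have h1 : 2 ^ i ≤ 2 ^ Λ := (hi2.trans ((Finset.card_le_univ K).trans (by simp))).trans hmΛ.le
    have h2 : 2 ^ i < 2 ^ Λ := lt_of_le_of_lt (hi2.trans ((Finset.card_le_univ K).trans (by simp))) hmΛ
    exact Nat.succ_le_of_lt ((Nat.pow_lt_pow_iff_right (by norm_num)).1 h2)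
  have hKi : 1000 * (i + 1) * (i + 2) ≤ Kx := by
    rw [hKx]
    have : (i + 1) * (i + 2) ≤ Λ * (Λ + 1) := Nat.mul_le_mul hiΛ (by omega)
    nlinarith
  have hX1 : ∀ W ⊆ U, 3 * W.card ≤ r → 186 * W.card ≤ 125 * (nbr S U W).card := fun W hW h3 =>
    nbr_small hcw hℓ' (fun k _ => hexp1 k) (by omega) hLS hUK htouch hW h3
  have hX2 : ∀ W ⊆ U, 2 * W.card ≤ U.card → 3 * W.card ≤ 4 * Kx * (nbr S U W).card := by
    intro W hW h2
    have h := card_le_nbr hcw hℓ' (fun k _ => hexp1 k) (by omega) hLS hUK htouch hstop hW h2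
    calc 3 * W.card ≤ 4000 * (i + 1) * (i + 2) * (nbr S U W).card := h
      _ = 4 * (1000 * (i + 1) * (i + 2)) * (nbr S U W).card := by ring
      _ ≤ 4 * Kx * (nbr S U W).card := by gcongr
  -- parameters
  have hq1 : 1 ≤ q := by rw [hq, hp]; nlinarith
  have hKx1 : 1 ≤ Kx := by
    rw [hKx]
    have : 1 ≤ Λ := by
      rcases Nat.eq_zero_or_pos Λ with h | h
      · subst h; simp at hmΛ; subst hmΛ
        exact absurd (Finset.card_le_univ K) (by simp; exact Finset.card_pos.2 ⟨_, (hKne.choose_spec)⟩ |>.ne' |> fun h => by omega)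
      · exact h
    nlinarith
  have hpq : 3 * (p + 1) * q ≤ r := by
    have h1 : 3 * (p + 1) * q ≤ (12 * Kx + 3) * (p * q + p * p * L) := by
      rcases Nat.eq_zero_or_pos p with h | h
      · rw [h] at hq; rw [h, hq]; simp
      · have : 3 * (p + 1) * q ≤ 6 * (p * q) := by nlinarith
        have : p * q ≤ p * q + p * p * L := Nat.le_add_right _ _
        nlinarith
    omega
  have hUm : U.card ≤ m := (Finset.card_le_univ U).trans (by simp)
  have hs' : (2 * Kx) ^ s * U.card < (2 * Kx + 1) ^ s :=
    lt_of_le_of_lt (Nat.mul_le_mul_left _ hUm) hs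
  -- branch sets and the clique minor
  obtain ⟨F, hFc, hFm, hFd⟩ := exists_branch_family hX1 hUr hq1 hpq ht
  have h8 : 8 * p * L ≤ q := by rw [hq]
  have hvol' : (12 * Kx + 3) * (p * q + p * p * L) + 3 ≤ r := hvol
  obtain ⟨G, hGF, hpG, T, hT1, hT2⟩ := exists_clique_minor hX1 hX2 hs' ht hFc hFm hFd hq1 hvol' h8
  -- index `m₁` members of `G`
  have hm₁G : m₁ ≤ G.card := by omega
  set f : Fin m₁ → Finset (Fin m) := fun a => (G.equivFin.symm (Fin.castLE hm₁G a)).1 with hf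
  have hfG : ∀ a, f a ∈ G := fun a => (G.equivFin.symm (Fin.castLE hm₁G a)).2
  have hfinj : Function.Injective f := by
    intro a b h
    have := Subtype.ext h
    exact Fin.castLE_injective hm₁G (G.equivFin.symm.injective this)
  refine ⟨fun a => T (f a), fun a => ?_, fun a b hab => (hT2 (f a) (hfG a) (f b) (hfG b)
    (fun h => hab (hfinj h))).1, fun a b hab => (hT2 (f a) (hfG a) (f b) (hfG b) (fun h => hab (hfinj h))).2⟩
  obtain ⟨hBT, hTU, hTc⟩ := hT1 (f a) (hfG a)
  refine ⟨hTU.trans hUK, hTc, ?_⟩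
  have hB := hFm (f a) (hGF (hfG a))
  exact (Finset.card_pos.1 (by rw [hB.2.2]; exact hq1)).mono hBT

end Summit.PneNP.PneNP.Theorems.ColumnTwo
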